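import Summits.CriticalPhenomena.PercolationContinuityZ3.Theorems.PercNearOneGluingNoHeavyLowerTailLiftTransferLeFive
import Summits.CriticalPhenomena.PercolationContinuityZ3.Theorems.PercNearOneGluingNoHeavyLowerTailE3GroupSepLeFive

/-!
# `NoHeavyLowerTail` (crux stmt-CriticalPhenomena-4575): the lift-transfer inequality (S2) of prim-ineq-gen-6 with BLOCK targets — five labelled vertices, every weighted
# graph on five vertices, ALL edge weights (kernel-checked, three-copy comb positive)

Support file (prover seat `prim-bnk-1`; `--supports stmt-CriticalPhenomena-4575`; COMPUTATIONAL: four `checkC` evaluations use `native_decide`).  Companion of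
`…LiftTransferLeFive` (connectivity target `A = {a ↔ b}`, `n ≤ 5`).

(S2) (prim-ineq-gen-6 FINDING-G5 §4): for vertices `x, y, a` and ANY increasing event `A` of the cluster of `a`,
  `(μ(X ∩ A) − μ(X)μ(A)) · μ(Yᶜ) ≥ μ(U ∩ Yᶜ) · (μ(Y ∩ A) − μ(Y)μ(A))`,   `X = {x↔a}, Y = {y↔a}, U = {x↔y}`.
Here the targets are the BLOCK targets of two relays `b₁, b₂` (the level-`t` events of the CSL ladder) and two variants involving `x`:
  `A₁ = {a↔b₁} ∪ {a↔b₂}` (level 1),  `A₂ = {a↔b₁} ∩ {a↔b₂}` (level 2),  `A₃ = A₁ ∪ {a↔x}`,  `A₄ = A₁ ∩ {a↔x}`.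
**Theorems `liftTransferBlock_five (i : Fin 4)`** (term form) and `liftTransfer_level1_five`, `liftTransfer_level2_five` (probability form): for every
`w : Sym2 (Fin 5) → [0,1]` and all pairwise distinct `x y a b₁ b₂ : Fin 5` the inequality holds.  (Five distinct labelled vertices need `n ≥ 5`; graphs on five vertices with
missing edges are the weight-0 faces, so this is the complete `n ≤ 5` statement.)  PROOF: each signed cubic (`lbTerms i`) passes prim-cert-2's three-copy checker `checkC` at
the standard 5-tuple of `K₅` (`2^34`; zero/positive fibre counts of 4^10: A₁ 913 386/135 190, A₂ 867 574/181 002, A₃ 905 802/142 774, A₄ 790 482/258 094, 0 negative; two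
independent exact C implementations agree, run/shared/lean/prim/prim-l12/prim-bnk-1/) and is transported along vertex relabellings (`tmap`, `cover_distinct` of
`…E3GroupSepLeFive`).  Nothing is claimed beyond five vertices.
-/

namespace Summit.CriticalPhenomena.PercolationContinuityZ3.Theorems.LiftTransfer

open Finset MeasureTheory OneCutCert CovTransferCert E3GroupSepCert
open scoped BigOperators
open Literature.Probability.Percolation Literature.Probability.LatticeModels

variable {n : ℕ}

/-- `{u ↔ v} ∪ {u ↔ z}`. [this work] -/
def pJor (u v z : Fin n) : CRel n → Bool := fun r => r u v || r u z
/-- `({u ↔ v} ∪ {u ↔ z}) ∪ {u ↔ s}`. [this work] -/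
def pJor3 (u v z s : Fin n) : CRel n → Bool := fun r => (r u v || r u z) || r u s
/-- `({u ↔ v} ∪ {u ↔ z}) ∩ {u ↔ s}`. [this work] -/
def pJorJ (u v z s : Fin n) : CRel n → Bool := fun r => (r u v || r u z) && r u s

/-- The event of `pJor`. [this work] -/
theorem connEvent_pJor (u v z : Fin n) : connEvent (pJor u v z) = openConn u v ∪ openConn u z := by
  ext ω; simp [connEvent, pJor]
/-- The event of `pJor3`. [this work] -/
theorem connEvent_pJor3 (u v z s : Fin n) : connEvent (pJor3 u v z s) = (openConn u v ∪ openConn u z) ∪ openConn u s := by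
  ext ω; simp [connEvent, pJor3, or_assoc]
/-- The event of `pJorJ`. [this work] -/
theorem connEvent_pJorJ (u v z s : Fin n) : connEvent (pJorJ u v z s) = (openConn u v ∪ openConn u z) ∩ openConn u s := by
  ext ω; simp [connEvent, pJorJ, or_and_right]

/-- The target event `A_i` at the tuple `(x, y, a, b₁, b₂)`: `0 = A₁`, `1 = A₂`, `2 = A₃`, `3 = A₄`. [this work] -/
def target (i : Fin 4) (x a b₁ b₂ : Fin n) : CRel n → Bool :=
  match i with
  | 0 => pJor a b₁ b₂
  | 1 => pJJ a b₁ a b₂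
  | 2 => pJor3 a b₁ b₂ x
  | 3 => pJorJ a b₁ b₂ x

/-- The signed cubic of (S2) with target `A_i` at `t = (x, y, a, b₁, b₂)`:
`σ·μ(X ∩ A)·μ(Yᶜ) − μ(X)μ(A)μ(Yᶜ) − σ·μ(U ∩ Yᶜ)·μ(Y ∩ A) + μ(U ∩ Yᶜ)μ(Y)μ(A)`. [this work] -/
def lbTerms (i : Fin 4) (t : Tup n) : List (CTerm n) :=
  let x := t.1
  let y := t.2.1
  let a := t.2.2.1
  let b₁ := t.2.2.2.1
  let b₂ := t.2.2.2.2
  [(1, pTrue, pAnd (pJ x a) (target i x a b₁ b₂), pN y a), (-1, pJ x a, target i x a b₁ b₂, pN y a),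
    (-1, pTrue, pJN x y y a, pAnd (pJ y a) (target i x a b₁ b₂)), (1, pJN x y y a, pJ y a, target i x a b₁ b₂)]

/-- The terms under relabelling. [this work] -/
theorem lbTerms_relP (i : Fin 4) (τ : Fin n ≃ Fin n) (t : Tup n) :
    ((lbTerms i t).map fun z => (z.1, relP τ z.2.1, relP τ z.2.2.1, relP τ z.2.2.2)) = lbTerms i (tmap τ t) := by
  obtain ⟨x, y, a, b₁, b₂⟩ := t
  fin_cases i <;> rfl

/-- Transport along a relabelling. [this work] -/
theorem lb_relabel (i : Fin 4) (σ : Fin n ≃ Fin n) (w : Sym2 (Fin n) → unitInterval) (t : Tup n) (h : 0 ≤ cval w (lbTerms i t)) :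
    0 ≤ cval (relabelW σ w) (lbTerms i (tmap σ t)) := by
  rw [cval_map_relP, lbTerms_relP, tmap_symm_tmap]
  exact h

/-- Transport of validity at all weights. [this work] -/
theorem lb_forall_relabel (i : Fin 4) (σ : Fin n ≃ Fin n) {t : Tup n} (h : ∀ w : Sym2 (Fin n) → unitInterval, 0 ≤ cval w (lbTerms i t))
    (w : Sym2 (Fin n) → unitInterval) : 0 ≤ cval w (lbTerms i (tmap σ t)) := by
  have hw : relabelW σ (fun e => w (sym2Equiv σ e)) = w := by
    funext e
    unfold relabelW
    simp only [Equiv.apply_symm_apply]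
  rw [← hw]
  exact lb_relabel i σ _ t (h _)

/-- `K₅`: the four cubics pass the three-copy check at the standard 5-tuple (base `2^34`): all `4^10` fibre sums are `≥ 0`. [this work] -/
theorem checkLB5 (i : Fin 4) : checkC 5 34 (lbTerms i t₀) = true := by
  fin_cases i <;> native_decide

/-- **(S2) with block targets on five labelled vertices** (term form): for every weight vector on `K₅` and all pairwise distinct `x y a b₁ b₂`. [this work] -/
theorem liftTransferBlock_five (i : Fin 4) (w : Sym2 (Fin 5) → unitInterval) (x y a b₁ b₂ : Fin 5) (hxy : x ≠ y) (hxa : x ≠ a) (hx1 : x ≠ b₁)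
    (hx2 : x ≠ b₂) (hya : y ≠ a) (hy1 : y ≠ b₁) (hy2 : y ≠ b₂) (ha1 : a ≠ b₁) (ha2 : a ≠ b₂) (h12 : b₁ ≠ b₂) :
    0 ≤ cval w (lbTerms i (x, y, a, b₁, b₂)) := by
  obtain ⟨σ, hσ⟩ := cover_distinct _ (mem_distinctTuples hxy hxa hx1 hx2 hya hy1 hy2 ha1 ha2 h12)
  rw [← hσ]
  exact lb_forall_relabel i σ (fun w' => checkC_sound 34 _ (checkLB5 i) w') w

/-- **(S2), level-1 block target `A = {a↔b₁} ∪ {a↔b₂}`, on five vertices.** [this work] -/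
theorem liftTransfer_level1_five (w : Sym2 (Fin 5) → unitInterval) (x y a b₁ b₂ : Fin 5) (hxy : x ≠ y) (hxa : x ≠ a) (hx1 : x ≠ b₁)
    (hx2 : x ≠ b₂) (hya : y ≠ a) (hy1 : y ≠ b₁) (hy2 : y ≠ b₂) (ha1 : a ≠ b₁) (ha2 : a ≠ b₂) (h12 : b₁ ≠ b₂) :
    (prodBernoulli w).real (openConn x y ∩ (openConn y a)ᶜ) *
        ((prodBernoulli w).real (openConn y a ∩ (openConn a b₁ ∪ openConn a b₂)) -
          (prodBernoulli w).real (openConn y a) * (prodBernoulli w).real (openConn a b₁ ∪ openConn a b₂)) ≤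
      ((prodBernoulli w).real (openConn x a ∩ (openConn a b₁ ∪ openConn a b₂)) -
          (prodBernoulli w).real (openConn x a) * (prodBernoulli w).real (openConn a b₁ ∪ openConn a b₂)) *
        (prodBernoulli w).real (openConn y a)ᶜ := by
  have h := liftTransferBlock_five 0 w x y a b₁ b₂ hxy hxa hx1 hx2 hya hy1 hy2 ha1 ha2 h12
  unfold cval lbTerms target at h
  simp only [List.map_cons, List.map_nil, List.sum_cons, List.sum_nil, pr_pTrue] at h
  unfold pr at h
  simp only [connEvent_pAnd, connEvent_pJ, connEvent_pN, connEvent_pJN, connEvent_pJor] at h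
  push_cast at h
  linarith

/-- **(S2), level-2 block target `A = {a↔b₁} ∩ {a↔b₂}`, on five vertices.** [this work] -/
theorem liftTransfer_level2_five (w : Sym2 (Fin 5) → unitInterval) (x y a b₁ b₂ : Fin 5) (hxy : x ≠ y) (hxa : x ≠ a) (hx1 : x ≠ b₁)
    (hx2 : x ≠ b₂) (hya : y ≠ a) (hy1 : y ≠ b₁) (hy2 : y ≠ b₂) (ha1 : a ≠ b₁) (ha2 : a ≠ b₂) (h12 : b₁ ≠ b₂) :
    (prodBernoulli w).real (openConn x y ∩ (openConn y a)ᶜ) *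
        ((prodBernoulli w).real (openConn y a ∩ (openConn a b₁ ∩ openConn a b₂)) -
          (prodBernoulli w).real (openConn y a) * (prodBernoulli w).real (openConn a b₁ ∩ openConn a b₂)) ≤
      ((prodBernoulli w).real (openConn x a ∩ (openConn a b₁ ∩ openConn a b₂)) -
          (prodBernoulli w).real (openConn x a) * (prodBernoulli w).real (openConn a b₁ ∩ openConn a b₂)) *
        (prodBernoulli w).real (openConn y a)ᶜ := by
  have h := liftTransferBlock_five 1 w x y a b₁ b₂ hxy hxa hx1 hx2 hya hy1 hy2 ha1 ha2 h12
  unfold cval lbTerms target at h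
  simp only [List.map_cons, List.map_nil, List.sum_cons, List.sum_nil, pr_pTrue] at h
  unfold pr at h
  simp only [connEvent_pAnd, connEvent_pJ, connEvent_pN, connEvent_pJN, connEvent_pJJ] at h
  push_cast at h
  linarith

end Summit.CriticalPhenomena.PercolationContinuityZ3.Theorems.LiftTransfer
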